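import Summits.QuantumFields.YangMills.Theorems.VirialFluxGapPeriodicVolumeFloor
import Summits.QuantumFields.YangMills.Theorems.VirialFluxGapPeriodicSoftnessOfVolumeScaling
import HarnessLib

/-!
# Route `VirialFluxGap` (YangMills): `PeriodicSoftness` modulo the ONE-SIDED VOLUME SCALING LAW of the toron valley ALONE

The corollary of ✓`VolumeScaling.periodicSoftness_of_volumeScaling` (FLOOR → SCALING → `PeriodicSoftness`, w2 g51, p792308) and the floor
✓`VolumeFloor.exp_le_ringMeasure_real_deficit_le` (w3 g58: `exp(−150·L⁵·(1 + log t⁻¹)) ≤ μ_L{F₀ ≤ t}` on `(0,1]`): the deciding crux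
⟨stmt-QuantumFields-24141⟩ `VirialFluxGap.PeriodicSoftness` follows from

  SCALING: `∃ c > 0, K > 0, p ≥ 0, L₀: ∀ L ≥ L₀, ∀ t ∈ (0,(KL^p)⁻¹], ∀ θ ∈ (0,1]: θ^{9L⁴ − c} · μ_L{F₀ ≤ t} ≤ μ_L{F₀ ≤ θ·t}`

(`F₀ = RingDeficit.ringDeficit L 0` the zero-flux ring deficit, `μ_L = RingDeficit.ringMeasure L`): the sublevel volumes of the periodic deficit decay
no faster than `t^{9L⁴−c}` at polynomial scale — the toron valley has scaling codimension `≤ 18L⁴ − 2c` (prediction `18L⁴ − 3`).  This is the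
one-sided heart of memo `w2-g51-VOLUME-SCALING-24141.md` (evidence on the item): the output of the flow of an Euler-type field
(`V·∇F₀ ≥ 2(1 − o(L⁻⁴))F₀`, `div V ≤ 18L⁴ − 2c`), strictly weaker than the two-sided power-log tube law ⟨24497⟩ `ToronTubeVolumeLaw`; the
sibling IBP form of the same field (LEAD g92 evidence #15, w3 g58 `VirialMeanBound`) consumes the field without a flow.

* `periodicVolumeFloor` — the FLOOR hypothesis of ✓`periodicSoftness_of_volumeScaling`, CHARACTER-IDENTICAL, discharged by w3's floor
  (`A = 150`, `r = 5`, `L₀ = 1`);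
* ★★ `periodicSoftness_of_scaling : SCALING → Summit.QuantumFields.YangMills.Theses.VirialFluxGap.PeriodicSoftness`.

HONEST FRAMING: a REDUCTION — SCALING is NOT proved; ⟨24141⟩, the route VirialFluxGap (DRAFT) and every summit statement stay OPEN; the
Yang–Mills mass gap is NOT proved.  THEOREMS ONLY (0 `def`, 0 `sorry`), standard axioms.  Width seat `ym-line-sfw-p2-w2` g51 (cell ym-idea-1,
free hands), `--supports stmt-QuantumFields-24141`.  References: [cite: Luscher1983, §2]; [cite: MontvayMunster1994, (3.145)].
-/

set_option autoImplicit false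

noncomputable section

namespace Summit.QuantumFields.YangMills.Theorems.VirialFluxGap.VolumeScaling

open Summit.QuantumFields.YangMills.Theorems.VirialFluxGap.RingDeficit
open Summit.QuantumFields.YangMills.Theorems.VirialFluxGap.VolumeFloor (exp_le_ringMeasure_real_deficit_le)

/-- ★ **The FLOOR hypothesis of ✓`periodicSoftness_of_volumeScaling` holds** (`A = 150`, `r = 5`, `L₀ = 1`; w3 g58's
✓`VolumeFloor.exp_le_ringMeasure_real_deficit_le`). [cite: Luscher1983, §2] -/
theorem periodicVolumeFloor :
    ∃ A : ℝ, 0 < A ∧ ∃ r : ℝ, 0 ≤ r ∧ ∃ L₀ : ℕ, ∀ (L : ℕ) [NeZero L], L₀ ≤ L → ∀ t : ℝ, 0 < t → t ≤ 1 →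
      Real.exp (-(A * (L : ℝ) ^ r * (1 + Real.log t⁻¹))) ≤
        (ringMeasure L).real {P | ringDeficit L (fun _ => false) P ≤ t} := by
  refine ⟨150, by norm_num, 5, by norm_num, 1, ?_⟩
  intro L _ _ t ht0 ht1
  have e5 : ((L : ℕ) : ℝ) ^ (5 : ℝ) = (L : ℝ) ^ (5 : ℕ) := by exact_mod_cast Real.rpow_natCast (L : ℝ) 5
  rw [e5]
  exact exp_le_ringMeasure_real_deficit_le ht0 ht1

/-- ★★ **`PeriodicSoftness` modulo the SCALING LAW alone**: if the sublevel volumes of the zero-flux ring deficit obey the one-sided scaling law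
`θ^{9L⁴−c}·μ_L{F₀ ≤ t} ≤ μ_L{F₀ ≤ θt}` (`0 < θ ≤ 1`, `0 < t ≤ (KL^p)⁻¹`, `L ≥ L₀`) for some `c > 0`, then `VirialFluxGap.PeriodicSoftness` holds
(✓`periodicSoftness_of_volumeScaling` + `periodicVolumeFloor`).  A REDUCTION: the scaling law is NOT proved here; no crux / rung / summit is
proved; the YM mass gap is NOT proved. [cite: Luscher1983, §2] [cite: MontvayMunster1994, (3.145)] -/
theorem periodicSoftness_of_scaling
    (hscal : ∃ c : ℝ, 0 < c ∧ ∃ K : ℝ, 0 < K ∧ ∃ p : ℝ, 0 ≤ p ∧ ∃ L₀ : ℕ, ∀ (L : ℕ) [NeZero L], L₀ ≤ L →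
      ∀ t : ℝ, 0 < t → t ≤ (K * (L : ℝ) ^ p)⁻¹ → ∀ θ : ℝ, 0 < θ → θ ≤ 1 →
        θ ^ (9 * (L : ℝ) ^ 4 - c) * (ringMeasure L).real {P | ringDeficit L (fun _ => false) P ≤ t} ≤
          (ringMeasure L).real {P | ringDeficit L (fun _ => false) P ≤ θ * t}) :
    Summit.QuantumFields.YangMills.Theses.VirialFluxGap.PeriodicSoftness :=
  periodicSoftness_of_volumeScaling periodicVolumeFloor hscal

end Summit.QuantumFields.YangMills.Theorems.VirialFluxGap.VolumeScaling

end
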